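import Summits.ResolutionOfSingularities.ResolutionOfSingularities.Theorems.EquisingularLiftEquisingularLiftNatExactShadowStalkData
import Summits.ResolutionOfSingularities.ResolutionOfSingularities.Theorems.EquisingularLiftEquisingularLiftNatExactShadowStalk
import Summits.ResolutionOfSingularities.ResolutionOfSingularities.Theorems.EquisingularLiftEquisingularLiftNatNonEquimultipleFibre
import Summits.ResolutionOfSingularities.ResolutionOfSingularities.Theorems.EquisingularLiftEquisingularLiftNatCarrierDeltaFrameAdapted
import HarnessLib

/-!
# [OURS · L1 W4.5(b) · EL♮(3)] E-NEG(1), part (iv)(a) — an exact shadow is EQUIMULTIPLE along the section: the INTRINSIC FORM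
# «`ord_q(D♭_k) ≤ ord_s(D♭)`» at the ambient stalk `R = 𝒪_{X₁,q}` (crux `EquisingularLiftNatThree` = stmt-ResolutionOfSingularities-20148,
# parent stmt-20038)

NOT a statement of any manuscript. Helper file of the chain res-L1-w45b (cell `res-hironaka`, rung L, slot W4.5(b)); AI-written, weaker than
expert review; filed `--supports stmt-ResolutionOfSingularities-20148 --as helper`; it closes nothing. Object (O1) E-NEG(1) of res-L1-w45b-plan-1's
PLANNER-MEMO-g9-1 v1.1, conclusion (iv) «`D♭` is EQUIMULTIPLE along `s`» (res-L1-w45b-plan-1 WORD 2026-08-27T15:36:49Z (2): (iv)(a) = stub-4).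

THE STATEMENT (`stalkIdeal_le_sup_pow_of_exactShadow_of_frame'`). In the frame currency of part 3b-ii (`…NatExactShadowStalk`, p538737: the
exact-shadow SETTING of part 2, `D♭ := τ(supp C)` horizontal, a non-closed `ζ ⤳ q` of the curve, an ideal sheaf `J ⊇`-planar and irreducible
with `supp J ⊄ D♭`, and at `q = s(s₀)`: `R = 𝒪_{X₁,q}` regular of dimension `4`, `J_q = (c₀)`, `c₀ ∉ 𝔪²`, the uniformizer germ `ϖ_R ∉ 𝔪² + (c₀)`,
`(ker s)_q = (c₀, x₁, x₂)`), with `s` moreover a SECTION of the separated `τ₁ ≫ r`: for every `n`,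
**`𝓘(D♭)_q ≤ (c₀) + (ϖ_R) + 𝔪ⁿ ⟹ 𝓘(D♭)_q ≤ (c₀) + (ker s)_qⁿ`** — the order of the special fibre `D♭_k` at `q` (inside the carrier plane
`E_k`) does not exceed the order of `D♭` along the section (the reverse inequality being trivial): the lift passes through the section WITH ITS FULL
MULTIPLICITY.

PROOF (assembly). In the carrier germ `A = R/(c₀)` (regular of dimension `3`) the prime of `D♭` is `(g)` (p534378 / p537428: coheight two ⇒
principal); by induction on `n`, `g = Φ(x̄)` with `Φ` a form of degree `n − 1` over the section coordinates `x̄ = (x̄₁, x̄₂)`; if `g ∉ (x̄)ⁿ` then `Φ̄ ≠ 0`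
over `A/(x̄) ≅ O` while `ḡ ∈ 𝔪̄ⁿ` puts every coefficient of `Φ` in `(x̄) + (ϖ̄)` (the coefficient criterion of part (iv)(c-2),
`coeff_mem_sup_span_of_eval_mem`, quasi-regularity of `x̄` modulo `ϖ̄` from the regular surface germ `R/(c₀, ϖ_R)`); part (iv)(c-2)
`exists_chartPrimes_of_forall_coeff_mem` (over res-L1-w45b-stub-2's ring core p543997) then yields two comparable primes of the chart algebra of
the restricted centre at the point of `V(D♭)_red` under `q`, which part (iv)(c-1) `not_chartPrimes_of_exactShadow` (p545525, with
res-L1-w45b-stub-2's p544313) forbids under `hfib`.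

References: H. Matsumura, *Commutative Ring Theory* (1986), §16, Thms. 14.2, 17.4; The Stacks Project, Tags 080E, 0804, 07Z3 — through the cited tree
files. OURS planning text (index only): L/w45b/PLANNER-MEMO-g9-1.md v1.1 §1 (iv).
-/

set_option linter.dupNamespace false -- mandated namespace `Summit.<Summit>.<Problem>` of this single-conjunct summit
set_option linter.overlappingInstances false -- signatures carry `[IsDomain O] [IsDiscreteValuationRing O]`

noncomputable section

open CategoryTheory AlgebraicGeometry TopologicalSpace Topology IsLocalRing MvPolynomial
open AlgebraicGeometry.Scheme.IdealSheafData Literature.AlgebraicGeometry.Resolution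

namespace Summit.ResolutionOfSingularities.ResolutionOfSingularities.Cruxes.EquisingularLiftNat.Sections

/-! ## The exact-shadow setting: ring data at `q`, and (iv) -/

section Equimultiple

variable {O : Type} [CommRing O] [IsDomain O] [IsDiscreteValuationRing O] {P X₁ X₂ : Scheme.{0}}
  [IsLocallyNoetherian X₁] [IsLocallyNoetherian X₂]

omit [IsLocallyNoetherian X₂] in
/-- **The ring data at `q` of an exact shadow** (the facts derived inside part 3b-ii's `range_subset_image_support_of_exactShadow_of_frame'`,
exported): the point `z` of `V(D♭)_red` over `q`, `𝓘(D♭)_q` prime, `c₀ ∈ 𝓘(D♭)_q ∌ ϖ_R`, `ϖ_R, c₀ ∈ 𝔪`, and `dim R ⧸ 𝓘(D♭)_q = 2`.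
[cite: Matsumura1987, §5 p. 31, Thm. 17.4; StacksProject, Tag 01J7] [OURS · L1 W4.5b] -/
theorem exists_exactShadow_stalkData (r : P ⟶ Spec (.of O)) (τ₁ : X₁ ⟶ P) (s : Spec (.of O) ⟶ X₁)
    (τ : X₂ ⟶ X₁) (hτ : IsBlowup τ s.ker) (Γ : Set X₁) (C : X₂.IdealSheafData) (hCint : IsIntegral C.subscheme)
    (hCsp : (C.support : Set X₂) ∩ (CategoryStruct.comp τ (CategoryStruct.comp τ₁ r)) ⁻¹' {closedPoint O} =
      closure (τ ⁻¹' (Γ \ (s.ker.support : Set X₁))))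
    (hD : IsClosed (τ '' (C.support : Set X₂)))
    (hhor : ¬ τ '' (C.support : Set X₂) ⊆ (CategoryStruct.comp τ₁ r) ⁻¹' {closedPoint O})
    (hζ : ∃ ζ ∈ closure (Γ \ (s.ker.support : Set X₁)), ζ ⤳ s (closedPoint O) ∧ ζ ≠ s (closedPoint O))
    (J : X₁.IdealSheafData) (hJirr : IsIrreducible (J.support : Set X₁)) (hDJ : τ '' (C.support : Set X₂) ⊆ (J.support : Set X₁))
    (hJD : ¬ (J.support : Set X₁) ⊆ τ '' (C.support : Set X₂))
    {q : X₁} (hsq : s (closedPoint O) = q) [IsRegularLocalRing (X₁.presheaf.stalk q)] (h4 : ringKrullDim (X₁.presheaf.stalk q) = (4 : ℕ))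
    {ϖ : O} (hϖ : Irreducible ϖ) (c₀ : X₁.presheaf.stalk q) (hJq : stalkIdeal J q = Ideal.span {c₀})
    (hc₀2 : c₀ ∉ maximalIdeal _ ^ 2) :
    ∃ z : ↥(vanishingIdeal (⟨τ '' (C.support : Set X₂), hD⟩ : Closeds X₁)).subscheme,
      (vanishingIdeal (⟨τ '' (C.support : Set X₂), hD⟩ : Closeds X₁)).subschemeι z = q ∧
      (stalkIdeal (vanishingIdeal (⟨τ '' (C.support : Set X₂), hD⟩ : Closeds X₁)) q).IsPrime ∧
      c₀ ∈ stalkIdeal (vanishingIdeal (⟨τ '' (C.support : Set X₂), hD⟩ : Closeds X₁)) q ∧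
      (X₁.presheaf.Γgerm q).hom ((CategoryStruct.comp τ₁ r).appTop.hom ((Scheme.ΓSpecIso (.of O)).inv.hom ϖ)) ∉
        stalkIdeal (vanishingIdeal (⟨τ '' (C.support : Set X₂), hD⟩ : Closeds X₁)) q ∧
      (X₁.presheaf.Γgerm q).hom ((CategoryStruct.comp τ₁ r).appTop.hom ((Scheme.ΓSpecIso (.of O)).inv.hom ϖ)) ∈ maximalIdeal _ ∧
      c₀ ∈ maximalIdeal _ ∧
      ringKrullDim (X₁.presheaf.stalk q ⧸ stalkIdeal (vanishingIdeal (⟨τ '' (C.support : Set X₂), hD⟩ : Closeds X₁)) q) = (2 : ℕ) := by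
  classical
  haveI := hCint
  set D : Set X₁ := τ '' (C.support : Set X₂) with hDdef
  set g : Γ(X₁, ⊤) := (CategoryStruct.comp τ₁ r).appTop.hom ((Scheme.ΓSpecIso (.of O)).inv.hom ϖ) with hg
  have hF : X₁.zeroLocus ({g} : Set Γ(X₁, ⊤)) = (CategoryStruct.comp τ₁ r) ⁻¹' {closedPoint O} :=
    zeroLocus_appTop_eq_preimage_closedPoint hϖ (CategoryStruct.comp τ₁ r)
  obtain ⟨ζ, hζcl, hζq, hζne⟩ := hζ
  have hclsub := closure_diff_support_subset_of_exactShadow r τ₁ s τ hτ Γ C hCsp hD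
  have hq : s (closedPoint O) ∈ closure (Γ \ (s.ker.support : Set X₁)) := hζq.mem_closed isClosed_closure hζcl
  have hqD : q ∈ D := by rw [← hsq]; exact (hclsub hq).1
  have hqF : q ∈ X₁.zeroLocus ({g} : Set Γ(X₁, ⊤)) := by rw [hF, ← hsq]; exact (hclsub hq).2
  set 𝔇 := vanishingIdeal (⟨D, hD⟩ : Closeds X₁) with h𝔇
  have hrange : Set.range 𝔇.subschemeι = D := by
    rw [Scheme.IdealSheafData.range_subschemeι, h𝔇, Scheme.IdealSheafData.coe_support_vanishingIdeal]; rfl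
  obtain ⟨z, hz⟩ : q ∈ Set.range 𝔇.subschemeι := by rw [hrange]; exact hqD
  subst hz
  refine ⟨z, rfl, ?_⟩
  -- `D` irreducible with generic point `η ⤳ q`, `𝓘(D)_q = 𝔭_η`
  have hCirr : IsIrreducible (C.support : Set X₂) := by
    rw [← Scheme.IdealSheafData.range_subschemeι, ← Set.image_univ]
    exact (IrreducibleSpace.isIrreducible_univ _).image _ C.subschemeι.continuous.continuousOn
  have hDirr : IsIrreducible D := hCirr.image _ τ.continuous.continuousOn
  set η := hDirr.genericPoint with hηdef
  have hηD : closure ({η} : Set X₁) = D := hDirr.closure_genericPoint hD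
  have hηq : η ⤳ 𝔇.subschemeι z := specializes_iff_mem_closure.mpr (hηD ▸ hqD)
  have h𝔓 : stalkIdeal 𝔇 (𝔇.subschemeι z) = primeOfSpecializes hηq := by
    have h := stalkIdeal_vanishingIdeal_closure (X := X₁) (p := 𝔇.subschemeι z) hηq
    convert h using 3
    exact Closeds.ext hηD.symm
  have hprime : (stalkIdeal 𝔇 (𝔇.subschemeι z)).IsPrime := by rw [h𝔓]; infer_instance
  have hηF : η ∉ X₁.zeroLocus ({g} : Set Γ(X₁, ⊤)) := by
    intro h
    apply hhor
    rw [← hF, ← hηD]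
    exact closure_minimal (Set.singleton_subset_iff.mpr h) (X₁.zeroLocus_isClosed _)
  have hϖ𝔓 : (X₁.presheaf.Γgerm (𝔇.subschemeι z)).hom g ∉ stalkIdeal 𝔇 (𝔇.subschemeι z) := by
    rw [h𝔓, Γgerm_mem_primeOfSpecializes_iff]
    exact hηF
  have hrefl : primeOfSpecializes (specializes_refl (𝔇.subschemeι z)) = maximalIdeal (X₁.presheaf.stalk (𝔇.subschemeι z)) := by
    change (maximalIdeal _).comap (X₁.presheaf.stalkSpecializes (specializes_refl _)).hom = _
    rw [TopCat.Presheaf.stalkSpecializes_refl]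
    exact Ideal.comap_id _
  have hϖm : (X₁.presheaf.Γgerm (𝔇.subschemeι z)).hom g ∈ maximalIdeal _ := by
    have h := (Γgerm_mem_primeOfSpecializes_iff (specializes_refl (𝔇.subschemeι z)) g).mpr hqF
    rwa [hrefl] at h
  have hηJ : η ∈ (J.support : Set X₁) := hDJ (hηD ▸ subset_closure (Set.mem_singleton η))
  have hJ𝔓 : stalkIdeal J (𝔇.subschemeι z) ≤ stalkIdeal 𝔇 (𝔇.subschemeι z) := by
    rw [h𝔓]; exact (mem_support_iff_stalkIdeal_le_primeOfSpecializes hηq J).mp hηJ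
  have hc𝔓 : c₀ ∈ stalkIdeal 𝔇 (𝔇.subschemeι z) := hJ𝔓 (hJq ▸ Ideal.mem_span_singleton_self c₀)
  have hc₀m : c₀ ∈ maximalIdeal _ := (IsLocalRing.le_maximalIdeal hprime.ne_top) hc𝔓
  -- the chains `𝔓 < 𝔭_ζ < 𝔪` and `(0) < (c₀) < 𝔓`
  rw [hsq] at hζq hζne
  have hζD : ζ ∈ D := (hclsub hζcl).1
  have hζF : ζ ∈ X₁.zeroLocus ({g} : Set Γ(X₁, ⊤)) := by rw [hF]; exact (hclsub hζcl).2
  have hηζ : η ⤳ ζ := specializes_iff_mem_closure.mpr (hηD ▸ hζD)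
  have hηζne : η ≠ ζ := fun h => hηF (h ▸ hζF)
  have h23 : stalkIdeal 𝔇 (𝔇.subschemeι z) < primeOfSpecializes hζq := by
    rw [h𝔓]; exact primeOfSpecializes_lt_of_ne hζq hηζ hηζne
  have h34 : primeOfSpecializes hζq < maximalIdeal _ := primeOfSpecializes_lt_maximalIdeal hζq hζne
  obtain ⟨hA, -⟩ := IsRegularLocalRing.quotient_span_singleton hc₀m hc₀2
  haveI : IsDomain (X₁.presheaf.stalk (𝔇.subschemeι z) ⧸ Ideal.span {c₀}) := @isDomain_of_isRegularLocalRing _ _ hA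
  haveI hP₁ : (Ideal.span ({c₀} : Set (X₁.presheaf.stalk (𝔇.subschemeι z)))).IsPrime :=
    (Ideal.Quotient.isDomain_iff_prime _).mp inferInstance
  have hP₁ne : Ideal.span ({c₀} : Set (X₁.presheaf.stalk (𝔇.subschemeι z))) ≠ ⊥ := by
    rw [Ne, Ideal.span_singleton_eq_bot]
    rintro rfl
    exact hc₀2 (Ideal.zero_mem _)
  have h12 : Ideal.span {c₀} < stalkIdeal 𝔇 (𝔇.subschemeι z) := by
    refine lt_of_le_of_ne ((Ideal.span_singleton_le_iff_mem _).mpr hc𝔓) fun heq => hJD ?_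
    set ξ := hJirr.genericPoint with hξdef
    have hξJ : closure ({ξ} : Set X₁) = (J.support : Set X₁) := hJirr.closure_genericPoint J.support.isClosed
    have hqJ : 𝔇.subschemeι z ∈ (J.support : Set X₁) := hDJ hqD
    have hξq : ξ ⤳ 𝔇.subschemeι z := specializes_iff_mem_closure.mpr (hξJ ▸ hqJ)
    have hξη : ξ ⤳ η := specializes_iff_mem_closure.mpr (hξJ ▸ hηJ)
    have hξJ' : ξ ∈ (J.support : Set X₁) := by rw [← hξJ]; exact subset_closure (Set.mem_singleton ξ)
    have hle₂ : primeOfSpecializes hηq ≤ primeOfSpecializes hξq := by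
      rw [← h𝔓, ← heq, ← hJq]
      exact (mem_support_iff_stalkIdeal_le_primeOfSpecializes hξq J).mp hξJ'
    have hξηeq : ξ = η := by
      by_contra hne
      exact (lt_irrefl _) ((primeOfSpecializes_lt_of_ne hηq hξη hne).trans_le hle₂)
    change (J.support : Set X₁) ⊆ D
    rw [← hξJ, hξηeq, hηD]
  haveI := hprime
  have h2 : ringKrullDim (X₁.presheaf.stalk (𝔇.subschemeι z) ⧸ stalkIdeal 𝔇 (𝔇.subschemeι z)) = (2 : ℕ) :=
    ringKrullDim_quotient_eq_two_of_chain h4 hP₁ne h12 h23 h34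
  exact ⟨hprime, hc𝔓, hϖ𝔓, hϖm, hc₀m, h2⟩

/-- **E-NEG(1) (iv) — the lift is EQUIMULTIPLE along the section (intrinsic form, generic point).** In the frame currency of part 3b-ii
(`range_subset_image_support_of_exactShadow_of_frame'`), with `s` a section of the separated `τ₁ ≫ r`: for every `n`,
`𝓘(D♭)_q ≤ (c₀) + (ϖ_R) + 𝔪ⁿ ⟹ 𝓘(D♭)_q ≤ (c₀) + (ker s)_qⁿ` — `ord_q(D♭_k) ≤ ord_s(D♭)`: the order of the special fibre of the shadow's
image at `q` (in the carrier plane) never exceeds its order along the section. See the module docstring for the proof.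
[cite: Matsumura1987, Thm. 14.2, §16, Thm. 17.4; StacksProject, Tag 080E, Tag 0804, Tag 07Z3] [OURS · L1 W4.5b] -/
theorem stalkIdeal_le_sup_pow_of_exactShadow_of_frame' (r : P ⟶ Spec (.of O)) (τ₁ : X₁ ⟶ P) [IsSeparated (CategoryStruct.comp τ₁ r)]
    (s : Spec (.of O) ⟶ X₁) [IsClosedImmersion s] (hs : CategoryStruct.comp s (CategoryStruct.comp τ₁ r) = CategoryStruct.id _)
    (τ : X₂ ⟶ X₁) (hτ : IsBlowup τ s.ker) (Γ : Set X₁) (hΓinf : (Γ \ (s.ker.support : Set X₁)).Infinite)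
    (C : X₂.IdealSheafData) (hCint : IsIntegral C.subscheme)
    (hCsp : (C.support : Set X₂) ∩ (CategoryStruct.comp τ (CategoryStruct.comp τ₁ r)) ⁻¹' {closedPoint O} =
      closure (τ ⁻¹' (Γ \ (s.ker.support : Set X₁))))
    (hfib : ∀ c₁ c₀ : X₂, c₁ ∈ (C.support : Set X₂) → c₀ ∈ (C.support : Set X₂) → τ c₁ = s (closedPoint O) →
      τ c₀ = s (closedPoint O) → c₁ ⤳ c₀ → c₁ = c₀)
    (hD : IsClosed (τ '' (C.support : Set X₂)))
    (hhor : ¬ τ '' (C.support : Set X₂) ⊆ (CategoryStruct.comp τ₁ r) ⁻¹' {closedPoint O})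
    (hζ : ∃ ζ ∈ closure (Γ \ (s.ker.support : Set X₁)), ζ ⤳ s (closedPoint O) ∧ ζ ≠ s (closedPoint O))
    (J : X₁.IdealSheafData) (hJirr : IsIrreducible (J.support : Set X₁)) (hDJ : τ '' (C.support : Set X₂) ⊆ (J.support : Set X₁))
    (hJD : ¬ (J.support : Set X₁) ⊆ τ '' (C.support : Set X₂))
    {q : X₁} (hsq : s (closedPoint O) = q) [IsRegularLocalRing (X₁.presheaf.stalk q)] (h4 : ringKrullDim (X₁.presheaf.stalk q) = (4 : ℕ))
    {ϖ : O} (hϖ : Irreducible ϖ) (c₀ x₁ x₂ : X₁.presheaf.stalk q) (hJq : stalkIdeal J q = Ideal.span {c₀})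
    (hc₀2 : c₀ ∉ maximalIdeal _ ^ 2)
    (hϖ2 : (X₁.presheaf.Γgerm q).hom ((CategoryStruct.comp τ₁ r).appTop.hom ((Scheme.ΓSpecIso (.of O)).inv.hom ϖ)) ∉
      maximalIdeal _ ^ 2 ⊔ Ideal.span {c₀})
    (hK : stalkIdeal s.ker q = Ideal.span {c₀, x₁, x₂}) (n : ℕ)
    (hn : stalkIdeal (vanishingIdeal (⟨τ '' (C.support : Set X₂), hD⟩ : Closeds X₁)) q ≤
      Ideal.span {c₀} ⊔ Ideal.span {(X₁.presheaf.Γgerm q).hom ((CategoryStruct.comp τ₁ r).appTop.hom ((Scheme.ΓSpecIso (.of O)).inv.hom ϖ))} ⊔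
        maximalIdeal _ ^ n) :
    stalkIdeal (vanishingIdeal (⟨τ '' (C.support : Set X₂), hD⟩ : Closeds X₁)) q ≤ Ideal.span {c₀} ⊔ (stalkIdeal s.ker q) ^ n := by
  classical
  obtain ⟨z, hz, hprime, hc𝔓, hϖ𝔓, hϖm, hc₀m, h2⟩ :=
    exists_exactShadow_stalkData r τ₁ s τ hτ Γ C hCint hCsp hD hhor hζ J hJirr hDJ hJD hsq h4 hϖ c₀ hJq hc₀2
  subst hz
  -- the section frame on `(c₀, x₁, x₂)`
  have hr3 : Set.range ![c₀, x₁, x₂] = {c₀, x₁, x₂} := range_fin_three _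
  have hcI : Ideal.span (Set.range ![c₀, x₁, x₂]) = stalkIdeal s.ker _ := by rw [hr3, hK]
  obtain ⟨θc, -, hcdom, -, h𝔪c, -⟩ := exists_sectionFrame_of_span_eq_forall_at O (CategoryStruct.comp τ₁ r) s hs _ hsq inferInstance
    ϖ hϖ ![c₀, x₁, x₂] hcI h4
  rw [hr3] at hcdom h𝔪c
  rw [hK]
  -- induction on `n`
  induction n with
  | zero =>
    rw [pow_zero, Ideal.one_eq_top, sup_top_eq]
    exact le_top
  | succ m ih =>
    have hm : stalkIdeal (vanishingIdeal (⟨τ '' (C.support : Set X₂), hD⟩ : Closeds X₁)) _ ≤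
        Ideal.span {c₀} ⊔ Ideal.span {c₀, x₁, x₂} ^ m :=
      ih (hn.trans (sup_le_sup_left (Ideal.pow_le_pow_right m.le_succ) _))
    by_contra hnot
    obtain ⟨c, hc, 𝔔₁, 𝔔₀, h1, h0, hle, hne⟩ := exists_chartPrimes_of_stalkData _ s.ker z h4 c₀ _ x₁ x₂ hc₀m hc₀2 hϖm hϖ2 hK h𝔪c
      hcdom hprime hc𝔓 h2 hm hnot hn
    exact hne (not_chartPrimes_of_exactShadow r τ₁ s τ hτ Γ hΓinf C hCint hCsp hfib hD z hsq.symm c hc 0 𝔔₁ 𝔔₀ h1 h0 hle)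

/-- **E-NEG(1) (iv) at `q := s(s₀)`** (`stalkIdeal_le_sup_pow_of_exactShadow_of_frame'` with `q := s(s₀)`): an exact shadow with zero-dimensional
fibre over `q` forces the image `D♭` to be EQUIMULTIPLE along the section — together with part 3b-ii's (iii) `s(Spec O) ⊆ D♭`: «the lift passes
through the section with its full multiplicity» (PLANNER-MEMO-g9-1 §1 (iii)+(iv)). [cite: Matsumura1987, Thm. 14.2, §16, Thm. 17.4;
StacksProject, Tag 080E, Tag 0804] [OURS · L1 W4.5b] -/
theorem stalkIdeal_le_sup_pow_of_exactShadow_of_frame (r : P ⟶ Spec (.of O)) (τ₁ : X₁ ⟶ P) [IsSeparated (CategoryStruct.comp τ₁ r)]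
    (s : Spec (.of O) ⟶ X₁) [IsClosedImmersion s] (hs : CategoryStruct.comp s (CategoryStruct.comp τ₁ r) = CategoryStruct.id _)
    (τ : X₂ ⟶ X₁) (hτ : IsBlowup τ s.ker) (Γ : Set X₁) (hΓinf : (Γ \ (s.ker.support : Set X₁)).Infinite)
    (C : X₂.IdealSheafData) (hCint : IsIntegral C.subscheme)
    (hCsp : (C.support : Set X₂) ∩ (CategoryStruct.comp τ (CategoryStruct.comp τ₁ r)) ⁻¹' {closedPoint O} =
      closure (τ ⁻¹' (Γ \ (s.ker.support : Set X₁))))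
    (hfib : ∀ c₁ c₀ : X₂, c₁ ∈ (C.support : Set X₂) → c₀ ∈ (C.support : Set X₂) → τ c₁ = s (closedPoint O) →
      τ c₀ = s (closedPoint O) → c₁ ⤳ c₀ → c₁ = c₀)
    (hD : IsClosed (τ '' (C.support : Set X₂)))
    (hhor : ¬ τ '' (C.support : Set X₂) ⊆ (CategoryStruct.comp τ₁ r) ⁻¹' {closedPoint O})
    (hζ : ∃ ζ ∈ closure (Γ \ (s.ker.support : Set X₁)), ζ ⤳ s (closedPoint O) ∧ ζ ≠ s (closedPoint O))
    (J : X₁.IdealSheafData) (hJirr : IsIrreducible (J.support : Set X₁)) (hDJ : τ '' (C.support : Set X₂) ⊆ (J.support : Set X₁))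
    (hJD : ¬ (J.support : Set X₁) ⊆ τ '' (C.support : Set X₂))
    [IsRegularLocalRing (X₁.presheaf.stalk (s (closedPoint O)))]
    (h4 : ringKrullDim (X₁.presheaf.stalk (s (closedPoint O))) = (4 : ℕ))
    {ϖ : O} (hϖ : Irreducible ϖ) (c₀ x₁ x₂ : X₁.presheaf.stalk (s (closedPoint O)))
    (hJq : stalkIdeal J (s (closedPoint O)) = Ideal.span {c₀}) (hc₀2 : c₀ ∉ maximalIdeal _ ^ 2)
    (hϖ2 : (X₁.presheaf.Γgerm (s (closedPoint O))).hom
      ((CategoryStruct.comp τ₁ r).appTop.hom ((Scheme.ΓSpecIso (.of O)).inv.hom ϖ)) ∉ maximalIdeal _ ^ 2 ⊔ Ideal.span {c₀})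
    (hK : stalkIdeal s.ker (s (closedPoint O)) = Ideal.span {c₀, x₁, x₂}) (n : ℕ)
    (hn : stalkIdeal (vanishingIdeal (⟨τ '' (C.support : Set X₂), hD⟩ : Closeds X₁)) (s (closedPoint O)) ≤
      Ideal.span {c₀} ⊔ Ideal.span {(X₁.presheaf.Γgerm (s (closedPoint O))).hom
        ((CategoryStruct.comp τ₁ r).appTop.hom ((Scheme.ΓSpecIso (.of O)).inv.hom ϖ))} ⊔ maximalIdeal _ ^ n) :
    stalkIdeal (vanishingIdeal (⟨τ '' (C.support : Set X₂), hD⟩ : Closeds X₁)) (s (closedPoint O)) ≤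
      Ideal.span {c₀} ⊔ (stalkIdeal s.ker (s (closedPoint O))) ^ n :=
  stalkIdeal_le_sup_pow_of_exactShadow_of_frame' r τ₁ s hs τ hτ Γ hΓinf C hCint hCsp hfib hD hhor hζ J hJirr hDJ hJD rfl h4 hϖ
    c₀ x₁ x₂ hJq hc₀2 hϖ2 hK n hn

end Equimultiple

end Summit.ResolutionOfSingularities.ResolutionOfSingularities.Cruxes.EquisingularLiftNat.Sections

end
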